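import Mathlib.Analysis.Calculus.Deriv.Comp
import Mathlib.Analysis.Calculus.Deriv.Add
import Mathlib.Analysis.Calculus.ContDiff.Basic
import Mathlib.Analysis.Calculus.ContDiff.Deriv
import Mathlib.Analysis.Calculus.Deriv.Slope
import HarnessLib

/-!
# The odd extension of a function vanishing at the origin ([Elgindi2021] §7.1, the sine series
`Ψ = ΣΨ_n(R)sin(2nθ)` "recalling the boundary conditions")

Topic `Literature/Analysis/FluidPDE`. Support file (one definition with body, everything proved;
no named facts) on the proof path of the named fact
`Literature.Analysis.FluidPDE.Elgindi.ElgindiGhoulMasmoudi2021_stabilityCore`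
(`ElgindiStabilityDecomposition.lean`). T. M. Elgindi, Ann. of Math. 194 (2021) =
arXiv:1904.04795, §7.1 proof of Proposition 7.1 (p. 19): the Dirichlet data `Ψ(R,0) = Ψ(R,π/2) = 0`
make the odd extension of `Ψ(R,·)` a `C¹` periodic function whose Fourier series is the sine series
`ΣΨ_n(R)sin(2nθ)`. This file: the odd extension `oddExt φ` of `φ : ℝ → ℝ` and its `C¹` regularity
when `φ ∈ C¹` and `φ(0) = 0` (`contDiff_one_oddExt`), with its derivative `x ↦ φ'(|x|)`.
-/

noncomputable section

open Set Filter
open _root_.Topology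

namespace Literature.Analysis.FluidPDE

namespace Elgindi

/-- The odd extension `x ↦ φ(x)` (`x ≥ 0`), `x ↦ −φ(−x)` (`x < 0`). [folklore] -/
def oddExt (φ : ℝ → ℝ) (x : ℝ) : ℝ :=
  if 0 ≤ x then φ x else -φ (-x)

/-- On `x ≥ 0` the odd extension is `φ`. [folklore] -/
theorem oddExt_of_nonneg (φ : ℝ → ℝ) {x : ℝ} (hx : 0 ≤ x) : oddExt φ x = φ x := by
  simp [oddExt, hx]

/-- On `x < 0` the odd extension is `−φ(−x)`. [folklore] -/
theorem oddExt_of_neg (φ : ℝ → ℝ) {x : ℝ} (hx : x < 0) : oddExt φ x = -φ (-x) := by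
  simp [oddExt, not_le.2 hx]

/-- The odd extension is odd when `φ(0) = 0`. [folklore] -/
theorem oddExt_neg (φ : ℝ → ℝ) (h0 : φ 0 = 0) (x : ℝ) : oddExt φ (-x) = -oddExt φ x := by
  rcases lt_trichotomy x 0 with hx | rfl | hx
  · rw [oddExt_of_neg φ hx, oddExt_of_nonneg φ (by linarith)]; ring
  · simp [oddExt, h0]
  · rw [oddExt_of_nonneg φ hx.le, oddExt_of_neg φ (by linarith)]; simp

/-- **The odd extension of a `C¹` function vanishing at `0` is differentiable everywhere with
derivative `φ'(|x|)`.** [folklore] -/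
theorem hasDerivAt_oddExt {φ : ℝ → ℝ} (hφ : ContDiff ℝ 1 φ) (h0 : φ 0 = 0) (x : ℝ) :
    HasDerivAt (oddExt φ) (deriv φ |x|) x := by
  have hd : Differentiable ℝ φ := hφ.differentiable (by simp)
  rcases lt_trichotomy x 0 with hx | rfl | hx
  · -- locally `−φ(−·)`
    have hloc : oddExt φ =ᶠ[𝓝 x] fun y => -φ (-y) :=
      Filter.eventuallyEq_of_mem (Iio_mem_nhds hx) fun y hy => oddExt_of_neg φ hy
    have h : HasDerivAt (fun y => -φ (-y)) (deriv φ (-x)) x := by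
      have h1 : HasDerivAt (fun y => φ (-y)) (deriv φ (-x) * -1) x :=
        ((hd (-x)).hasDerivAt).comp x (hasDerivAt_neg x)
      exact h1.fun_neg.congr_deriv (by ring)
    rw [abs_of_neg hx]
    exact h.congr_of_eventuallyEq hloc
  · -- at the origin: both one-sided derivatives are `φ'(0)`
    rw [abs_zero]
    have hR : HasDerivWithinAt (oddExt φ) (deriv φ 0) (Ici 0) 0 := by
      have h := ((hd 0).hasDerivAt).hasDerivWithinAt (s := Ici 0)
      exact h.congr_of_mem (fun y hy => oddExt_of_nonneg φ hy) self_mem_Ici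
    have hL : HasDerivWithinAt (oddExt φ) (deriv φ 0) (Iic 0) 0 := by
      have h1 : HasDerivAt (fun y => -φ (-y)) (deriv φ 0) 0 := by
        have h2 : HasDerivAt (fun y => φ (-y)) (deriv φ (-0) * -1) 0 :=
          ((hd (-0)).hasDerivAt).comp 0 (hasDerivAt_neg 0)
        exact h2.fun_neg.congr_deriv (by simp)
      refine (h1.hasDerivWithinAt (s := Iic 0)).congr_of_mem (fun y hy => ?_) self_mem_Iic
      have hy' : y ≤ 0 := hy
      rcases eq_or_lt_of_le hy' with h | h
      · subst h; simp [oddExt, h0]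
      · exact oddExt_of_neg φ h
    have h := hL.union hR
    rw [Iic_union_Ici] at h
    exact h.hasDerivAt Filter.univ_mem
  · have hloc : oddExt φ =ᶠ[𝓝 x] φ :=
      Filter.eventuallyEq_of_mem (Ioi_mem_nhds hx) fun y hy => oddExt_of_nonneg φ (le_of_lt hy)
    rw [abs_of_pos hx]
    exact ((hd x).hasDerivAt).congr_of_eventuallyEq hloc

/-- The derivative of the odd extension. [folklore] -/
theorem deriv_oddExt {φ : ℝ → ℝ} (hφ : ContDiff ℝ 1 φ) (h0 : φ 0 = 0) (x : ℝ) :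
    deriv (oddExt φ) x = deriv φ |x| :=
  (hasDerivAt_oddExt hφ h0 x).deriv

/-- **The odd extension of `φ ∈ C¹` with `φ(0) = 0` is `C¹`.** [folklore] -/
theorem contDiff_one_oddExt {φ : ℝ → ℝ} (hφ : ContDiff ℝ 1 φ) (h0 : φ 0 = 0) : ContDiff ℝ 1 (oddExt φ) := by
  rw [show (1 : WithTop ℕ∞) = 0 + 1 by rfl, contDiff_succ_iff_deriv]
  refine ⟨fun x => (hasDerivAt_oddExt hφ h0 x).differentiableAt, fun h => absurd h (by simp), ?_⟩
  have e : deriv (oddExt φ) = fun x => deriv φ |x| := funext fun x => deriv_oddExt hφ h0 x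
  rw [e]
  exact contDiff_zero.2 ((hφ.continuous_deriv le_rfl).comp continuous_abs)

/-- The odd extension is continuous. [folklore] -/
theorem continuous_oddExt {φ : ℝ → ℝ} (hφ : ContDiff ℝ 1 φ) (h0 : φ 0 = 0) : Continuous (oddExt φ) :=
  (contDiff_one_oddExt hφ h0).continuous

end Elgindi

end Literature.Analysis.FluidPDE
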